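import Summits.BirchSwinnertonDyer.Rank1Residual.Additive.CongruentPartnerMainConjectureGord
import Summits.BirchSwinnertonDyer.Rank1Residual.Additive.ChiBranchLowerTransport
import Summits.BirchSwinnertonDyer.Rank1Residual.Additive.GordCharLeadingTermConsequences
import Summits.BirchSwinnertonDyer.Rank1Residual.Additive.GordThreeCycLowerCore
import Summits.BirchSwinnertonDyer.Rank1Residual.Additive.GordCycLeadingTermTwist
import Summits.BirchSwinnertonDyer.Rank1Residual.Additive.TypeGThree
import HarnessLib

/-!
# "X4 ROUTE G" on X4♯(G-ord) ∩ `I₀*` ∩ {`ρ̄` onto}, rank ZERO: from the budget / partner main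
# conjecture to the `T = 0` LOWER input `CycLowerLeadingTermAt` and to `BSD(E,p)` off the anomalous
# rows — every `p ≥ 5` (A175) and `p = 3` (p16's `mainTheorem_three`) (team n1011, seat p10 gen 2,
# OWNERS row T-E3d FILE 3; skeleton `cells/n1011/skel/T-E3d.md`)

HONEST FRAMING (cell `b2b-bsdres`, run/shared/lean/b2b/bsd-rank1-residual/, verbatim in every
file): the goal of the cell is to DELETE the COMBINATION-SHAPED residual classes of the
Birch–Swinnerton-Dyer formula for ALL analytic-rank `≤ 1` elliptic curves over `ℚ` — "full BSD
formula for every rank `≤ 1` curve in class `C`" assembled STRICTLY from published theorems — so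
that the rank-`≤ 1` remainder becomes exactly the CONSTRUCTION-SHAPED classes, which are TYPED
(missing-input `Prop`s), NOT attempted. This is not "finishing BSD". Team n1011 (N10/N11: X4 ∧
`p = 3`): research route on the CONSTRUCTION-SHAPED class X4; prove what is provable now; no claim
beyond stated classes; census output = EVIDENCE / conjecture items, never a Literature fact;
X4♯(G-ord) stays CONSTRUCTION-SHAPED; RESIDUAL-MAP marks (§I N10/N11) UNCHANGED; nothing is booked by
this file. Theorems only (no definition, no named fact); every published input is an explicit
named-fact hypothesis (`hK`, `hPal`, `hDel98`, `hDel`/`hDel3`, `hGZK`, `hmod`, `hmodD`).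

## What and why

FILE 2 (`CongruentPartnerMainConjectureGord.lean`) turns Kato's divisibility + ONE unit coefficient at
index `b` + the typed budget bound `BudgetLeLambdaAt p W b` (or a congruent partner) into the
Λ-adic LOWER inputs `ChiBranchLowerDivisibility[Odd]At W p`. THIS FILE composes them, BY NAME, with the
existing `T = 0` chain of team n1011 / additive-p2: p07's `chiBranchLowerLeadingTerm[Odd]At_of_divisibility…`
(Λ-adic ⟹ `T = 0`) and `cycLowerLeadingTermAt_iff_chiBranchLower[Odd]_of_typeGOrd_…` (branch ↔
cyclotomic currency; Birch, Pal 2012 Thm. 3.2 at `p ≡ 1 (mod 4)`), then additive-p2's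
`ClassX4Gord.bsdp_rankZero_of_cycLeadingTerm_of_cycLower_of_nonAnomalous` (`p ≥ 5`: Delbourgo 2002
(A)+(B) = A175, Delbourgo 1998 Prop. 4, Kato's upper half) and n1011-p18's
`ClassX4Gord.bsdp_three_rankZero_of_cycLower_of_nonAnomalous_of_surj` (`p = 3`: `mainTheorem_three`,
p14's certificate-free tower). Results:
* `ClassX4Gord.cycLowerLeadingTermAt_of_katoHalf_of_coeffCert_of_budget` — every odd `p`: the
  residual map's `X_D1` at `T = 0` (LOWER divisibility of Delbourgo's MC) HOLDS on a row with a unit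
  coefficient at index `b` and the budget bound `b ≤ λ` (EPW Cor 3.2.5 per curve);
* `ClassX4Gord.bsdp_rankZero_of_katoHalf_of_coeffCert_of_budget_of_nonAnomalous` (`p ≥ 5`) and
  `ClassX4Gord.bsdp_three_rankZero_of_katoHalf_of_coeffCert_of_budget_of_nonAnomalous` (`p = 3`):
  `BSD(E,p)` on X4♯(G-ord) ∩ `I₀*` ∩ {`ρ̄` onto} ∧ `r_an = 0` ∧ non-CM ∧ non-anomalous, from the
  named facts + the two per-pair inputs (certificate index `b`, budget) — partner-free; the
  congruent-partner twin `…_of_congruentPartner_of_nonAnomalous` (`TorsionIso`, `CongruentLambdaShift`,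
  the partner's `μ = 0` and `r₁ ≤ λ(X(E₁))` for SOME cyclotomic torsion datum — hence for the one the
  kernel meets);
* §4 (`p ≡ 3 (mod 4)`, appended on referee 1 GEN 8's note): `…cycLowerLeadingTermAt_…_of_mod_four_eq_three`
  and `ClassX4Gord.bsdp_three_rankZero_…_of_nonAnomalous_noPal` — the same endpoints WITHOUT the Pal 2012
  binder `hPal`, which is idle on the odd branch (Birch's `Ω⁻`-relation only).
Binder honesty (skeleton §4; referee 1 ACK-1 provisos, 2026-08-21T07:36Z): `hna` is decidable per
pair (p254456: `reductionNonAnomalous_iff_of_semistabilityIndex_eq_two`); `hcm` decidable (`j`); the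
budget binder `BudgetLeLambdaAt p W b` is always meant with `b = B(E,p)`, the `p`-Tamagawa budget of
ROUTE-2 II.9.2 (EPW Cor. 3.2.5 per curve, OUTSIDE the kernel; it stays a binder); wherever the partner
schema `CongruentLambdaShift` is consumed, EPW Thm. 3.3.3 (ω^i-form, LIT-INPUTS-P3 §11.1 p0019
L147–166) is applied on the HIDA FAMILY of `ρ̄_{E♭}` (the `p`-ordinary twist model) at `i = (p−1)/2`,
NEVER on `f_E` itself (`a_p(E) = 0`); `∀ D₁, μ = 0` at the partner stays a hypothesis; the certificate /
budget / partner data are instrument tier or typed schemata — EVIDENCE until certified, booking =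
director per pair; nothing booked.

References: [Kato2004Asterisque] Thm. 17.4 (3); [Delbourgo2002] Thm. (A), (B); [Delbourgo1998] Prop. 4;
[Pal2012] Thm. 3.2; [EmertonPollackWeston2006] §3; [GreenbergVatsal2000] §2; [Miller2011LMS] Def. 1.1.
-/

set_option autoImplicit false

noncomputable section

open scoped Classical MatrixGroups ModularForm NumberField

open CongruenceSubgroup WeierstrassCurve NumberField Literature.NumberTheory.EllipticCurves
  Literature.NumberTheory.EllipticCurves.ModularForms
  Literature.NumberTheory.EllipticCurves.Rank1Residual
  Literature.NumberTheory.EllipticCurves.Rank1Residual.Typed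
  Literature.NumberTheory.GaloisRepresentations
  Literature.NumberTheory.EllipticCurves.Wuthrich2014
  Literature.NumberTheory.EllipticCurves.GreenbergVatsal2000
  Literature.NumberTheory.EllipticCurves.Delbourgo2002
  Summit.BirchSwinnertonDyer.Rank1Residual.AdditivePotMult
  Summit.BirchSwinnertonDyer.Rank1Residual.X1.MuLambda
  Summit.BirchSwinnertonDyer.Rank1Residual.Iwasawa
  IsDedekindDomain

open Summit.BirchSwinnertonDyer.Rank1Residual.X1.CongruenceTransfer (TorsionIso CongruentLambdaShift)

namespace Summit.BirchSwinnertonDyer.Rank1Residual.Additive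

variable {W : WeierstrassCurve ℚ} [W.IsElliptic] [W.IsGloballyMinimal] {p : ℕ} [hp : Fact p.Prime]

/-! ### §1 The `T = 0` LOWER input `CycLowerLeadingTermAt` from the budget main conjecture -/

/-- **`X_D1` at `T = 0` HOLDS on a certified eligible row** (X4♯(G-ord) ∩ `I₀*` ∩ {`ρ̄` onto}, every odd
`p`): Kato half + `BranchUnitCoeffAt W p b` + `BudgetLeLambdaAt p W b` (`b = B(E,p)`) ⟹ `CycLowerLeadingTermAt W p`
(every generator `f` of `char_Λ X(E/ℚ_∞)` has `q ∣ f(0)`, `q = L(E,1)/Ω_E`), via the Λ-adic LOWER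
inputs (FILE 2), p07's Λ-adic ⟹ `T = 0` and branch ↔ cyclotomic bridges (Birch; Pal at `p ≡ 1 (4)`).
[cite: Kato2004Asterisque, Thm. 17.4 (3) (p. 273)] [cite: Pal2012, Thm. 3.2]
[cite: MazurTateTeitelbaum1986Invent, §I.14] -/
theorem ClassX4Gord.cycLowerLeadingTermAt_of_katoHalf_of_coeffCert_of_budget
    (hK : Wuthrich2014.kato_halfEigenCharIdeal_dvd_cyclotomicPrime_of_surjective)
    (hPal : Pal2012.thm32_sqrt_mul_realPeriodRat_twist_eq_of_prime_one_mod_four)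
    (hmod : hasEntireLFunction_rat) (hmodD : nonempty_modularParametrizationData)
    (hX : ClassX4Gord W p) (he : semistabilityIndex W p = 2) (hsurj : Surj W p)
    {b : ℕ} (hcert : BranchUnitCoeffAt W p b) (hbud : BudgetLeLambdaAt p W b) :
    CycLowerLeadingTermAt W p := by
  have hp2 : p ≠ 2 := hX.addv.1
  have hj := padicValRat_j_nonneg_of_typeGOrd W p hX.typeGOrd
  have hodd : p % 4 = 1 ∨ p % 4 = 3 := by
    obtain ⟨k, hk⟩ := hp.out.odd_of_ne_two hp2
    omega
  rcases hodd with h1 | h3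
  · exact (cycLowerLeadingTermAt_iff_chiBranchLower_of_typeGOrd_of_semistabilityIndex_eq_two W p hPal
      hmod hmodD h1 hX.addv.2 hX.typeGOrd he).mpr
      (chiBranchLowerLeadingTermAt_of_divisibility_of_padicValRat_j_nonneg p W hj
        (hX.chiBranchLowerDivisibilityAt_of_katoHalf_of_coeffCert_of_budget hK he hsurj hcert hbud))
  · exact (cycLowerLeadingTermAt_iff_chiBranchLowerOdd_of_typeGOrd_of_semistabilityIndex_eq_two W p
      hmod hmodD h3 hX.addv.2 hX.typeGOrd he).mpr
      (chiBranchLowerLeadingTermOddAt_of_divisibilityOdd_of_padicValRat_j_nonneg p W hj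
        (hX.chiBranchLowerDivisibilityOddAt_of_katoHalf_of_coeffCert_of_budget hK he hsurj hcert hbud))

/-! ### §2 `BSD(E,p)` in rank `0` off the anomalous rows, `p ≥ 5` -/

/-- **X4♯(G-ord) ∩ `I₀*` ∩ {`ρ̄` onto}, `p ≥ 5`, `r_an = 0`, non-CM, non-anomalous: the LOWER half
`ord_p #Ш_an ≤ ord_p #Ш` from Kato half + ONE unit coefficient at index `b = B(E,p)` + the budget bound.**
[cite: Delbourgo2002, Theorem (A), (B) (p. 40)] [cite: Kato2004Asterisque, Thm. 17.4 (3) (p. 273)]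
[cite: Miller2011LMS, Def. 1.1] -/
theorem ClassX4Gord.missingLowerBoundAt_rankZero_of_katoHalf_of_coeffCert_of_budget_of_nonAnomalous
    (hK : Wuthrich2014.kato_halfEigenCharIdeal_dvd_cyclotomicPrime_of_surjective)
    (hPal : Pal2012.thm32_sqrt_mul_realPeriodRat_twist_eq_of_prime_one_mod_four)
    (hDel : Delbourgo2002.mainTheorem) (hGZK : rank_eq_analyticRank_of_analyticRank_le_one)
    (hmod : hasEntireLFunction_rat) (hmodD : nonempty_modularParametrizationData)
    (hX : ClassX4Gord W p) (hcm : ¬ W.HasCM) (hp5 : 5 ≤ p) (he : semistabilityIndex W p = 2)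
    (hsurj : Surj W p) (hr : W.analyticRank = 0)
    {b : ℕ} (hcert : BranchUnitCoeffAt W p b) (hbud : BudgetLeLambdaAt p W b)
    (hna : ReductionNonAnomalous W p) : MissingLowerBoundAt W p :=
  ClassX4Gord.missingLowerBoundAt_rankZero_of_cycLower_of_nonAnomalous hDel hGZK hmod hX hcm hp5 hr
    (hX.cycLowerLeadingTermAt_of_katoHalf_of_coeffCert_of_budget hK hPal hmod hmodD he hsurj hcert hbud) hna

/-- **X4♯(G-ord) ∩ `I₀*` ∩ {`ρ̄` onto}, `p ≥ 5`, `r_an = 0`, non-CM, non-anomalous: `BSD(E,p)` from the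
named facts + ONE unit coefficient at index `b = B(E,p)` + the budget bound `BudgetLeLambdaAt p W b`** —
partner-free Route G: upper half = Kato's component chain (`ClassX4Gord.cycLeadingTermAt_of_katoComponent`),
lower half = §1. [cite: Delbourgo2002, Theorem (A), (B) (p. 40)] [cite: Kato2004Asterisque, Thm. 17.4 (3) (p. 273)]
[cite: Delbourgo1998, Prop. 4 (p. 144)] [cite: Miller2011LMS, §1 and Def. 1.1] -/
theorem ClassX4Gord.bsdp_rankZero_of_katoHalf_of_coeffCert_of_budget_of_nonAnomalous
    (hK : Wuthrich2014.kato_halfEigenCharIdeal_dvd_cyclotomicPrime_of_surjective)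
    (hPal : Pal2012.thm32_sqrt_mul_realPeriodRat_twist_eq_of_prime_one_mod_four)
    (hDel98 : Delbourgo1998.prop4_rankZero_pow_dvd_constantCoeff) (hDel : Delbourgo2002.mainTheorem)
    (hGZK : rank_eq_analyticRank_of_analyticRank_le_one) (hmod : hasEntireLFunction_rat)
    (hmodD : nonempty_modularParametrizationData)
    (hX : ClassX4Gord W p) (hcm : ¬ W.HasCM) (hp5 : 5 ≤ p) (he : semistabilityIndex W p = 2)
    (hsurj : Surj W p) (hr : W.analyticRank = 0)
    {b : ℕ} (hcert : BranchUnitCoeffAt W p b) (hbud : BudgetLeLambdaAt p W b)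
    (hna : ReductionNonAnomalous W p) : BSDp W p :=
  ClassX4Gord.bsdp_rankZero_of_cycLeadingTerm_of_cycLower_of_nonAnomalous hDel98 hDel hGZK hmod hX hcm hp5
    hr
    (ClassX4Gord.cycLeadingTermAt_of_katoComponent W p
      (Kato2004.charIdeal_dvd_padicLFunctionBranch_component_of_surjective_of_half hK) hPal hmod hmodD hX
      hp5 he hsurj)
    (hX.cycLowerLeadingTermAt_of_katoHalf_of_coeffCert_of_budget hK hPal hmod hmodD he hsurj hcert hbud) hna

/-! ### §3 `BSD(E,3)` in rank `0` off the anomalous rows (`p = 3`: `mainTheorem_three`, p14's tower) -/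

/-- **X4♯(G-ord) at `3` (`I₀*` automatic) ∧ surj(3), `r_an = 0`, non-CM, non-anomalous: `BSD(E,3)`
from the named facts (Kato half, Delbourgo 1998 Prop. 4, Delbourgo 2002 AT 3 = `mainTheorem_three`,
GZK, modularity) + ONE 3-adic unit coefficient at index `b = B(E,3)` on the ω-branch of `E^{(−3)}` + the
budget bound.** [cite: Delbourgo2002, Theorem (A), (B) (p. 40), Hypothesis (p. 39)]
[cite: Kato2004Asterisque, Thm. 17.4 (3) (p. 273)] [cite: Delbourgo1998, Prop. 4 (p. 144)]
[cite: Miller2011LMS, §1 and Def. 1.1] -/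
theorem ClassX4Gord.bsdp_three_rankZero_of_katoHalf_of_coeffCert_of_budget_of_nonAnomalous
    [Fact (Nat.Prime 3)] {W : WeierstrassCurve ℚ} [W.IsElliptic] [W.IsGloballyMinimal]
    (hK : Wuthrich2014.kato_halfEigenCharIdeal_dvd_cyclotomicPrime_of_surjective)
    (hPal : Pal2012.thm32_sqrt_mul_realPeriodRat_twist_eq_of_prime_one_mod_four)
    (hDel98 : Delbourgo1998.prop4_rankZero_pow_dvd_constantCoeff)
    (hDel3 : Delbourgo2002.mainTheorem_three)
    (hGZK : rank_eq_analyticRank_of_analyticRank_le_one) (hmod : hasEntireLFunction_rat)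
    (hmodD : nonempty_modularParametrizationData)
    (hX : ClassX4Gord W 3) (hcm : ¬ W.HasCM) (hsurj : Surj W 3) (hr : W.analyticRank = 0)
    {b : ℕ} (hcert : BranchUnitCoeffAt W 3 b) (hbud : BudgetLeLambdaAt 3 W b)
    (hna : ReductionNonAnomalous W 3) : BSDp W 3 :=
  have he : semistabilityIndex W 3 = 2 := semistabilityIndex_eq_two_of_typeG_three W hX.typeGOrd.typeG hX.addv.2
  ClassX4Gord.bsdp_three_rankZero_of_cycLower_of_nonAnomalous_of_surj hDel3
    (Kato2004.charIdeal_dvd_padicLFunctionBranch_component_of_surjective_of_half hK) hDel98 hGZK hmod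
    hmodD hX hcm hr hsurj hna
    (hX.cycLowerLeadingTermAt_of_katoHalf_of_coeffCert_of_budget hK hPal hmod hmodD he hsurj hcert hbud)

/-! ### §4 `p ≡ 3 (mod 4)` (so `p = 3` in particular): the same WITHOUT the idle Pal binder
(referee 1 GEN 8 note: on the odd branch `ω^{(p−1)/2}`, `(p−1)/2` odd, the period input is Birch's
`Ω⁻`-relation inside p07's `…Odd…` bridge, and Pal 2012 Thm. 3.2 — a `p ≡ 1 (mod 4)` statement — is
never invoked) -/

/-- **`X_D1` at `T = 0` on a certified eligible row, `p ≡ 3 (mod 4)`, NO Pal binder**: Kato half +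
`BranchUnitCoeffAt W p b` + `BudgetLeLambdaAt p W b` (`b = B(E,p)`) ⟹ `CycLowerLeadingTermAt W p`, via
the ODD-parity Λ-adic LOWER input of FILE 2 and p07's odd bridge
`cycLowerLeadingTermAt_iff_chiBranchLowerOdd_of_typeGOrd_of_semistabilityIndex_eq_two` (Birch only).
The `p % 4 = 3` branch of `ClassX4Gord.cycLowerLeadingTermAt_of_katoHalf_of_coeffCert_of_budget`,
exposed with its honest binder list. [cite: Kato2004Asterisque, Thm. 17.4 (3) (p. 273)]
[cite: MazurTateTeitelbaum1986Invent, §I.14] -/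
theorem ClassX4Gord.cycLowerLeadingTermAt_of_katoHalf_of_coeffCert_of_budget_of_mod_four_eq_three
    (hK : Wuthrich2014.kato_halfEigenCharIdeal_dvd_cyclotomicPrime_of_surjective)
    (hmod : hasEntireLFunction_rat) (hmodD : nonempty_modularParametrizationData)
    (hX : ClassX4Gord W p) (he : semistabilityIndex W p = 2) (hsurj : Surj W p) (h3 : p % 4 = 3)
    {b : ℕ} (hcert : BranchUnitCoeffAt W p b) (hbud : BudgetLeLambdaAt p W b) :
    CycLowerLeadingTermAt W p :=
  (cycLowerLeadingTermAt_iff_chiBranchLowerOdd_of_typeGOrd_of_semistabilityIndex_eq_two W p hmod hmodD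
      h3 hX.addv.2 hX.typeGOrd he).mpr
    (chiBranchLowerLeadingTermOddAt_of_divisibilityOdd_of_padicValRat_j_nonneg p W
      (padicValRat_j_nonneg_of_typeGOrd W p hX.typeGOrd)
      (hX.chiBranchLowerDivisibilityOddAt_of_katoHalf_of_coeffCert_of_budget hK he hsurj hcert hbud))

/-- **X4♯(G-ord) at `3` ∧ surj(3), `r_an = 0`, non-CM, non-anomalous: `BSD(E,3)`, NO Pal binder** — the
`_noPal` twin of `ClassX4Gord.bsdp_three_rankZero_of_katoHalf_of_coeffCert_of_budget_of_nonAnomalous`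
(`3 % 4 = 3`, §4's odd bridge; every other binder unchanged: Kato half, Delbourgo 1998 Prop. 4,
Delbourgo 2002 AT 3 = `mainTheorem_three`, GZK, modularity, ¬CM, `hna`, ONE 3-adic unit coefficient at
index `b = B(E,3)` + the budget bound). [cite: Delbourgo2002, Theorem (A), (B) (p. 40), Hypothesis (p. 39)]
[cite: Kato2004Asterisque, Thm. 17.4 (3) (p. 273)] [cite: Delbourgo1998, Prop. 4 (p. 144)]
[cite: Miller2011LMS, §1 and Def. 1.1] -/
theorem ClassX4Gord.bsdp_three_rankZero_of_katoHalf_of_coeffCert_of_budget_of_nonAnomalous_noPal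
    [Fact (Nat.Prime 3)] {W : WeierstrassCurve ℚ} [W.IsElliptic] [W.IsGloballyMinimal]
    (hK : Wuthrich2014.kato_halfEigenCharIdeal_dvd_cyclotomicPrime_of_surjective)
    (hDel98 : Delbourgo1998.prop4_rankZero_pow_dvd_constantCoeff)
    (hDel3 : Delbourgo2002.mainTheorem_three)
    (hGZK : rank_eq_analyticRank_of_analyticRank_le_one) (hmod : hasEntireLFunction_rat)
    (hmodD : nonempty_modularParametrizationData)
    (hX : ClassX4Gord W 3) (hcm : ¬ W.HasCM) (hsurj : Surj W 3) (hr : W.analyticRank = 0)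
    {b : ℕ} (hcert : BranchUnitCoeffAt W 3 b) (hbud : BudgetLeLambdaAt 3 W b)
    (hna : ReductionNonAnomalous W 3) : BSDp W 3 :=
  have he : semistabilityIndex W 3 = 2 :=
    semistabilityIndex_eq_two_of_typeG_three W hX.typeGOrd.typeG hX.addv.2
  ClassX4Gord.bsdp_three_rankZero_of_cycLower_of_nonAnomalous_of_surj hDel3
    (Kato2004.charIdeal_dvd_padicLFunctionBranch_component_of_surjective_of_half hK) hDel98 hGZK hmod
    hmodD hX hcm hr hsurj hna
    (hX.cycLowerLeadingTermAt_of_katoHalf_of_coeffCert_of_budget_of_mod_four_eq_three hK hmod hmodD he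
      hsurj rfl hcert hbud)

end Summit.BirchSwinnertonDyer.Rank1Residual.Additive

end
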